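import Summits.SmoothPoincare4.SmoothPoincare4.Theorems.InformationMetricHadamardConvexEndRecognitionSphere
import Summits.SmoothPoincare4.SmoothPoincare4.Theses.InformationMetricHadamard
import Literature.Geometry.Riemannian.HopfRinowHeineBorel

/-!
# `HadamardConvexBoundarySphere` (route InformationMetricHadamard, item stmt-SmoothPoincare4-6016)

The recognition engine of route InformationMetricHadamard, proved: in a complete (closed distance
balls compact), simply connected Riemannian 5-manifold with sectional curvature `≤ 0`, a compact
convex (betweenness form) set `C` with nonempty interior whose frontier is the image of an injective
immersion `j` of a closed 4-manifold `N` has `N ≅ S⁴`. This is the case `n = 4` of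
`HadamardConvex.nonempty_diffeomorph_sphere_of_convex`
(`InformationMetricHadamardConvexEndRecognitionSphere.lean`) after two conversions: Heine–Borel ⇒
geodesic completeness (Hopf–Rinow, `isGeodesicallyComplete_iff_isCompact_setOf_edist_le`) and
`K ≤ 0` on all planes ⇒ `Rm(X,Y,Y,X) ≤ 0` (`curvatureForm_leviCivita_nonpos_of_orthonormal`).
Everything is proved (no `sorry`, no definition, no named fact).

References: J. M. Lee, *Introduction to Riemannian Manifolds* (2018), Thm. 12.8, Prop. 12.9,
Cor. 6.20; B. O'Neill, *Semi-Riemannian Geometry* (1983), Ch. 5, Thm. 21.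
-/

noncomputable section

-- the registered namespace `Summit.SmoothPoincare4.SmoothPoincare4.Theorems` repeats a component
set_option linter.dupNamespace false

open Set
open scoped Manifold ContDiff Topology

namespace Summit.SmoothPoincare4.SmoothPoincare4.Theorems

open Literature.Geometry.Lorentzian Literature.Geometry.Lorentzian.PseudoRiemannianMetric
  Literature.Geometry.Riemannian Literature.Geometry.Riemannian.SimpleAH

set_option maxSynthPendingDepth 3 in
/-- **`HadamardConvexBoundarySphere`** (item stmt-SmoothPoincare4-6016 of route
InformationMetricHadamard, verbatim): the smooth frontier of a compact convex body with an interior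
point in a complete simply connected Riemannian 5-manifold of nonpositive sectional curvature is
diffeomorphic to `S⁴` (Cartan–Hadamard, Lee 2018 Thm. 12.8, plus radial projection from an interior
point, `HadamardConvex.nonempty_diffeomorph_sphere_of_convex`). [cite: Lee2018, Thm. 12.8] -/
theorem hadamardConvexBoundarySphere_proof :
    _root_.Summit.SmoothPoincare4.SmoothPoincare4.Theses.InformationMetricHadamard.HadamardConvexBoundarySphere := by
  intro W _ _ _ _ _ _ G hG hcpt hsec C hCc hCi hC N _ _ _ _ _ _ j hj hjinj hjimm hjr
  -- the Levi-Civita connection of `G` and its regularity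
  haveI hLC : G.HasLeviCivita := G.hasLeviCivita
  have hk1 : ((1 : ℕ∞) : ℕ∞ω) + 1 ≤ ∞ := by
    rw [show ((1 : ℕ∞) : ℕ∞ω) + 1 = 2 by norm_num]
    exact WithTop.coe_le_coe.2 le_top
  have hktop : ((⊤ : ℕ∞) : ℕ∞ω) + 1 ≤ ∞ := le_of_eq rfl
  have h2 : (2 : ℕ∞ω) ≤ ∞ := WithTop.coe_le_coe.2 le_top
  haveI : CovariantDerivative.ContMDiffCovariantDerivative G.leviCivita 1 :=
    ⟨G.isLocallyContMDiff_leviCivita_holds 1 hk1 univ isOpen_univ⟩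
  haveI : CovariantDerivative.ContMDiffCovariantDerivative G.leviCivita ∞ :=
    ⟨G.isLocallyContMDiff_leviCivita_holds ⊤ hktop univ isOpen_univ⟩
  -- nonpositive sectional curvature ⇒ `Rm(X, Y, Y, X) ≤ 0` on all pairs
  have hLCiv : G.IsLeviCivita G.leviCivita := isLeviCivita_leviCivita_holds (g := G)
  have hsec' : ∀ (x : W) (X Y : TangentSpace (𝓡 5) x),
      G.curvatureForm G.leviCivita x X Y Y X ≤ 0 :=
    curvatureForm_leviCivita_nonpos_of_orthonormal h2 hG fun x X Y hX hY hXY ↦ by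
      rw [← sectionalCurvature_of_orthonormal G G.leviCivita x hX hY hXY]
      exact hsec _ hLCiv x X Y
  -- Heine–Borel ⇒ geodesically complete (Hopf–Rinow)
  haveI : LocallyPathConnectedSpace W :=
    ChartedSpace.locallyPathConnectedSpace (EuclideanSpace ℝ (Fin 5)) W
  have hc : IsGeodesicallyComplete G.leviCivita :=
    (isGeodesicallyComplete_iff_isCompact_setOf_edist_le G le_rfl hG).2 hcpt
  exact HadamardConvex.nonempty_diffeomorph_sphere_of_convex (n := 4) hG hc hsec' hCc hCi hC hj
    hjinj hjimm hjr

end Summit.SmoothPoincare4.SmoothPoincare4.Theorems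

end
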